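import Mathlib
import HarnessLib
import Summits.HubbardSuperconductivity.HubbardSuperconductivity.Theorems.KLProgrammeKLRegimeSplitFrameLemmas

/-!
# Route `KLProgramme` — child 2 (`CountertermOn`, DECOMP C4a in the counterterm scheme): the COUNTERTERM MAP
# `T(K) = K ⊖ D_N(K)` is a self-map of the frame ball as far as GEOMETRY goes (crux K3 `KLRegimeTwoPointLimit`,
# stmt-HubbardSuperconductivity-19937; seat p2)

The frame of the next approximation is `T(K) = K ⊖ D_N(K)`; its shift is the sum of the two-leg pieces,
`frameShift (T K) = Σ_{n ≤ N} ℓ_n(K)` (`frameShift_counterterm`, from the telescoping of `KLProgrammeKLRegimeSplitFrameLemmas`).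
Hence the sizes of (E3a) (`TwoLegSizes`, orders `j ≤ 2`) ALONE put `T(K)` in p2 g2's `FrameGeometry` class with
`a₀ = Σ_n twoLegBar 0 n`, `a₁ = Σ_n twoLegBar 1 n`, `A = b = Σ_n Σ_{j<3} twoLegBar j n` (the floor taken two-sidedly: no use of
(E3b) — the tangential floor of App. C is what allows LARGE regime constants `c`; for the existential `c` of K3 the two-sided
second-order size `A = O(U² + c)` suffices) — `frameGeometry_counterterm`; and on the covariance window, if those sums are small
(`a₀ ≤ 3/80`, `a₁ ≤ 1/2000`, `A ≤ 1/100`), `T(K)` has the geometric half `GeomConstants (frameLevel μ (T K)) 7 (3/80) (1/2) (3/200)`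
of `FrameOK` — `geomConstants_counterterm` (via `geomConstants_frameLevel_covWindow`); and (§3, appended) with the
renormalisation package's smoothness constants dominating the majorant constants, `T(K)` IS an admissible frame:
`frameOK_counterterm : … → FrameOK R U N μ (K ⊖ D_N(K))` (pieces `0 ⊖ ℓ_n(K)`) — the self-map half of child 2's successive
approximation.  Also: `evalM` of every frame is smooth (`contDiff_evalM`).  Proofs only.

References: HOME/P2-C4B.md §8.5 (child-2 plan); BGM 2006 Lemma 2.1; FST II Lemma 2.1.
-/

noncomputable section

namespace Summit.HubbardSuperconductivity.HubbardSuperconductivity.Theorems.KLRegimeSplit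

set_option linter.dupNamespace false -- summit = problem name (single-conjunct summit), D-0017

open Real Finset Literature.MathematicalPhysics.QuantumLattice Literature.Probability.LatticeModels
open Literature.MathematicalPhysics.QuantumLattice.FermiRG
open Summit.HubbardSuperconductivity.HubbardSuperconductivity.Theorems.KLProgrammeLegKernels
open Summit.HubbardSuperconductivity.HubbardSuperconductivity.Theorems.DispersionFlow

/-! ## §1 Frames are smooth on `Momentum` -/

/-- A coordinate of `Momentum = EuclideanSpace ℝ (Fin 2)` is smooth. -/
theorem contDiff_coord (i : Fin 2) {k : WithTop ℕ∞} : ContDiff ℝ k (fun q : Momentum => (WithLp.ofLp q) i) :=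
  (PiLp.proj 2 (fun _ : Fin 2 => ℝ) i : Momentum →L[ℝ] ℝ).contDiff

/-- The symmetrised harmonics are smooth on `Momentum`. -/
theorem contDiff_harmonicM (m n : ℕ) {k : WithTop ℕ∞} :
    ContDiff ℝ k (fun q : Momentum => TrigPolyC4v.harmonic m n (WithLp.ofLp q)) := by
  unfold TrigPolyC4v.harmonic
  exact (((Real.contDiff_cos.comp (contDiff_const.mul (contDiff_coord 0))).mul
      (Real.contDiff_cos.comp (contDiff_const.mul (contDiff_coord 1)))).add
    ((Real.contDiff_cos.comp (contDiff_const.mul (contDiff_coord 0))).mul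
      (Real.contDiff_cos.comp (contDiff_const.mul (contDiff_coord 1))))).div_const _

/-- **Every frame is smooth on `Momentum`** (`evalM A` is a finite sum of smooth harmonics). -/
theorem contDiff_evalM (A : TrigPolyC4v) {k : WithTop ℕ∞} : ContDiff ℝ k (evalM A) := by
  unfold evalM
  simp only [TrigPolyC4v.eval_def]
  exact ContDiff.sum fun m _ => ContDiff.sum fun n _ => contDiff_const.mul (contDiff_harmonicM m n)

/-! ## §2 The shift of the counterterm map is the sum of the two-leg pieces -/

section Model

variable (L M : ℕ) [NeZero L] [NeZero M]

/-- `frameShift K = -evalM K`. -/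
theorem frameShift_eq_neg_evalM (K : TrigPolyC4v) : frameShift K = fun q => -evalM K q := rfl

/-- **The shift of `T(K) = K ⊖ D_N(K)` is the sum of the pieces**: `frameShift (K ⊖ D_N(K)) = Σ_{n ≤ N} ℓ_n(K)` on `Momentum`. -/
theorem frameShift_counterterm (β U μ : ℝ) (K : TrigPolyC4v) (N : ℕ) :
    frameShift (fsub K (klTwoLegPoly L M β U μ K N)) =
      fun q => ∑ n ∈ range (N + 1), evalM (klTwoLegPiece L M β U μ K n) q := by
  funext q
  show -evalM (fsub K (klTwoLegPoly L M β U μ K N)) q = _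
  rw [evalM_fsub, sum_evalM_klTwoLegPiece]
  ring

/-- **The counterterm map preserves the frame GEOMETRY class, quantitatively**: if the two-leg pieces of `K` obey (E3a) at the
scales `n ≤ N` (majorants `twoLegBar`, assumed non-negative), then `T(K) = K ⊖ D_N(K)` satisfies p2 g2's `FrameGeometry` with
`a₀ = Σ_n twoLegBar 0 n`, `a₁ = Σ_n twoLegBar 1 n`, `A = b = Σ_n Σ_{j<3} twoLegBar j n`, on any tube `ē`. -/
theorem frameGeometry_counterterm {G : GeoConsts} {Q : EngConsts} {β U μ : ℝ} {K : TrigPolyC4v} {N : ℕ}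
    (hbar : ∀ j n, 0 ≤ twoLegBar G Q U j n) (hS : ∀ n ≤ N, TwoLegSizes L M G Q β U μ K n) (ebar : ℝ) :
    FrameGeometry (∑ n ∈ range (N + 1), twoLegBar G Q U 0 n) (∑ n ∈ range (N + 1), twoLegBar G Q U 1 n)
      (∑ n ∈ range (N + 1), ∑ j ∈ range 3, twoLegBar G Q U j n)
      (∑ n ∈ range (N + 1), ∑ j ∈ range 3, twoLegBar G Q U j n) ebar μ
      (fsub K (klTwoLegPoly L M β U μ K N)) := by
  have hF := frameShift_counterterm L M β U μ K N
  have hC : ∀ n, ContDiff ℝ 2 (evalM (klTwoLegPiece L M β U μ K n)) := fun n => contDiff_evalM _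
  -- every derivative of order `j ≤ 2` of the shift is bounded by the sum of the majorants of order `j`
  have hD : ∀ j ≤ 2, ∀ q : Momentum,
      ‖iteratedFDeriv ℝ j (frameShift (fsub K (klTwoLegPoly L M β U μ K N))) q‖ ≤
        ∑ n ∈ range (N + 1), twoLegBar G Q U j n := by
    intro j hj q
    rw [hF, iteratedFDeriv_fun_sum_apply fun n _ => (contDiff_evalM _).contDiffAt]
    refine (norm_sum_le _ _).trans (sum_le_sum fun n hn => ?_)
    exact hS n (Nat.lt_succ_iff.mp (mem_range.mp hn)) j (hj.trans (by norm_num)) q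
  have hsingle : ∀ j < 3, ∑ n ∈ range (N + 1), twoLegBar G Q U j n ≤
      ∑ n ∈ range (N + 1), ∑ j ∈ range 3, twoLegBar G Q U j n := fun j hj =>
    sum_le_sum fun n _ => single_le_sum (f := fun j => twoLegBar G Q U j n) (fun i _ => hbar i n) (mem_range.mpr hj)
  refine ⟨?_, ?_, ?_, ?_, ?_⟩
  · rw [hF]; exact ContDiff.sum fun n _ => hC n
  · intro p
    have h := hD 0 (by norm_num) p
    rwa [norm_iteratedFDeriv_zero, Real.norm_eq_abs] at h
  · intro p
    have h := hD 1 (by norm_num) p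
    rwa [norm_iteratedFDeriv_one] at h
  · intro p j hj
    exact (hD j hj p).trans (hsingle j (by omega))
  · intro p _ t _
    have h2 := (hD 2 le_rfl p).trans (hsingle 2 (by norm_num))
    have hq := abs_fderiv_fderiv_le (frameShift (fsub K (klTwoLegPoly L M β U μ K N))) p t t
    rw [← hessQuad_eq_fderiv_fderiv] at hq
    have ht : 0 ≤ ‖t‖ * ‖t‖ := by positivity
    have := (abs_le.mp (hq.trans (by nlinarith [h2, ht] :
      ‖iteratedFDeriv ℝ 2 (frameShift (fsub K (klTwoLegPoly L M β U μ K N))) p‖ * ‖t‖ * ‖t‖ ≤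
        (∑ n ∈ range (N + 1), ∑ j ∈ range 3, twoLegBar G Q U j n) * ‖t‖ ^ 2))).1
    linarith

/-- **… hence, on the covariance window, the geometric half of `FrameOK` for `T(K)`** when the summed majorants are small:
`Σ_n twoLegBar 0 n ≤ 3/80`, `Σ_n twoLegBar 1 n ≤ 1/2000`, `Σ_n Σ_{j<3} twoLegBar j n ≤ 1/100` (in the KL regime these sums are
`O(|U|)`, `O(U²)`, `O(U² + c)`: small for `U ≤ U₀(c)`, `c ≤ c₁`). -/
theorem geomConstants_counterterm {G : GeoConsts} {Q : EngConsts} {β U μ : ℝ} {K : TrigPolyC4v} {N : ℕ}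
    (hμ : μ ∈ Set.Icc (-1.05 : ℝ) (-0.15)) (hbar : ∀ j n, 0 ≤ twoLegBar G Q U j n)
    (hS : ∀ n ≤ N, TwoLegSizes L M G Q β U μ K n)
    (h0 : ∑ n ∈ range (N + 1), twoLegBar G Q U 0 n ≤ 3 / 80)
    (h1 : ∑ n ∈ range (N + 1), twoLegBar G Q U 1 n ≤ 1 / 2000)
    (h2 : ∑ n ∈ range (N + 1), ∑ j ∈ range 3, twoLegBar G Q U j n ≤ 1 / 100) :
    GeomConstants (frameLevel μ (fsub K (klTwoLegPoly L M β U μ K N))) 7 (3 / 80) (1 / 2) (3 / 200) :=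
  geomConstants_frameLevel_covWindow hμ (frameGeometry_counterterm L M hbar hS (3 / 40)) le_rfl h0
    (sum_nonneg fun n _ => hbar 1 n) h1 (h2.trans (by norm_num)) h2

end Model

/-! ## §3 The decomposition half: `T(K)` is an admissible frame (`FrameOK`) -/

section Admissible

variable (L M : ℕ) [NeZero L] [NeZero M]

/-- `(0 ⊖ A)(q) = -A(q)` on `Momentum`. -/
theorem evalM_fsub_zero (A : TrigPolyC4v) : evalM (fsub 0 A) = -evalM A := by
  funext q; rw [Pi.neg_apply, evalM_fsub]; simp [evalM]

/-- `T(K) = K ⊖ D_N(K)` evaluates to minus the sum of the pieces: `(T K)(p) = Σ_{n ≤ N} (0 ⊖ ℓ_n(K))(p)`. -/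
theorem eval_counterterm_eq_sum (β U μ : ℝ) (K : TrigPolyC4v) (N : ℕ) (p : Fin 2 → ℝ) :
    (fsub K (klTwoLegPoly L M β U μ K N)).eval p =
      ∑ n ∈ range (N + 1), (fsub 0 (klTwoLegPiece L M β U μ K n)).eval p := by
  simp only [eval_fsub, TrigPolyC4v.eval_zero, zero_sub, sum_neg_distrib, sum_eval_klTwoLegPiece]
  ring

/-- **The counterterm map lands in `FrameOK`** (both halves): on the covariance window, if the two-leg pieces of `K` obey (E3a)
at the scales `n ≤ N` with small summed majorants (as in `geomConstants_counterterm`) and the renormalisation package's smoothness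
constants dominate the per-scale majorant constants (`G.S j + Q.S' j·|U| ≤ R.Gfr j`, `j ≤ 4`), then `T(K) = K ⊖ D_N(K)` is an
ADMISSIBLE frame with `N + 1` pieces `0 ⊖ ℓ_n(K)`: `FrameOK R U N μ (T K)`.  (The self-map half of child 2's successive
approximation; the contraction half is `FrameLipschitz` summed.) -/
theorem frameOK_counterterm {G : GeoConsts} {Q : EngConsts} {R : RenConsts} {β U μ : ℝ} {K : TrigPolyC4v} {N : ℕ}
    (hμ : μ ∈ Set.Icc (-1.05 : ℝ) (-0.15)) (hbar : ∀ j n, 0 ≤ twoLegBar G Q U j n)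
    (hS : ∀ n ≤ N, TwoLegSizes L M G Q β U μ K n)
    (h0 : ∑ n ∈ range (N + 1), twoLegBar G Q U 0 n ≤ 3 / 80)
    (h1 : ∑ n ∈ range (N + 1), twoLegBar G Q U 1 n ≤ 1 / 2000)
    (h2 : ∑ n ∈ range (N + 1), ∑ j ∈ range 3, twoLegBar G Q U j n ≤ 1 / 100)
    (hR : ∀ j ≤ 4, G.S j + Q.S' j * |U| ≤ R.Gfr j) :
    FrameOK R U N μ (fsub K (klTwoLegPoly L M β U μ K N)) := by
  refine ⟨geomConstants_counterterm L M hμ hbar hS h0 h1 h2, fun n => fsub 0 (klTwoLegPiece L M β U μ K n),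
    eval_counterterm_eq_sum L M β U μ K N, fun n hn j hj q => ?_⟩
  rw [evalM_fsub_zero, iteratedFDeriv_neg_apply, norm_neg]
  refine (hS n hn j hj q).trans ?_
  unfold twoLegBar
  exact mul_le_mul_of_nonneg_right (mul_le_mul_of_nonneg_right (hR j hj) (uPow_nonneg j U))
    (zpow_nonneg (by norm_num) _)

end Admissible

end Summit.HubbardSuperconductivity.HubbardSuperconductivity.Theorems.KLRegimeSplit

end
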